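import Summits.BirchSwinnertonDyer.BirchSwinnertonDyer.Theses.ByReductionTypeAtTwo
import Summits.BirchSwinnertonDyer.BirchSwinnertonDyer.Theorems.ByReductionTypeAtTwoGoodOrdinaryPub
import Summits.BirchSwinnertonDyer.BirchSwinnertonDyer.Theorems.ByReductionTypeAtTwoOrdMissingLowerBoundDefs
import Summits.BirchSwinnertonDyer.Rank1Residual.X12.CMIsogenyInvariance
import Summits.BirchSwinnertonDyer.Rank1Residual.X2.RankOneHeegner
import Summits.BirchSwinnertonDyer.Rank1Residual.X2.IsogenyLineTypeGoodOrdinary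
import Literature.NumberTheory.EllipticCurves.ComplexMultiplicationLFunctionIsogenyHoldsProofs
import Literature.NumberTheory.EllipticCurves.IsogenyIdProofs
import HarnessLib

/-!
# Glue item `GoodOrdinaryRankZeroAtTwoOfChildrenIsoMLB` (stmt-BirchSwinnertonDyer-19578) of route
# ByReductionTypeAtTwo, PROVED (seat bsd-2adic-ord GEN 7; term of the planner's Sketch-K6, rider K-1 + K-6)

The K4 re-split of the parent crux `GoodOrdinaryRankZeroAtTwo` (19095): PUBLISHED inputs (19149) + the
Cassels / entire-`L` rider + the Kato half UP TO ISOGENY (`OrdKatoHalfAtTwoIso`, 19573) + the descent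
inequality (`OrdMissingLowerBoundAtTwo`, 19577 = the closed leaf
`Theorems.OrdHalvesAtTwo.OrdMissingLowerBoundAtTwo`, p429628) ⇒ `GoodOrdinaryRankZeroAtTwo`.
`goodOrdinaryRankZeroAtTwoOfChildrenIsoMLB_proof` proves the route decl VERBATIM: pick the isogenous
member `W′` carrying the Kato half; non-CM, analytic rank `0` and good ordinary reduction at `2` move
along the isogeny (`X12.hasCM_iff_of_isIsogenous`, `analyticRank_eq_of_isIsogenous'`,
`hasGoodReductionAtPrime_iff`, `not_dvd_frobeniusTrace_of_isIsogenous`); at `W′` the Kato half + Kato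
17.4 (1)(2)@2 + Greenberg 4.1@2 give the upper half
(`X5.O1.missingUpperBoundAt_two_of_mainConjectureLowerDivisibilityAtTwoOrd_of_kato`), the descent
inequality gives the lower half, hence `BSD(W′, 2)`; Cassels pulls it back to `W`
(`X2.bsdp_of_isIsogenous_of_bsdp`). THEOREMS ONLY; nothing asserted. (The seat's
`Theorems/ByReductionTypeAtTwoOrdKatoHalfIsogeny.lean` shows more: modulo the same PUB inputs the
∃-member Kato half IS the ∀-member Kato half — `KatoHalfIsogeny.ordKatoHalfAtTwo_iff_ordKatoHalfAtTwoIso`.)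

References: R. Greenberg, LNM 1716 (1999), Thm. 4.1; K. Kato, Astérisque 295 (2004), Thm. 17.4;
J. W. S. Cassels, J. reine angew. Math. 217 (1965); J. Milne, *Arithmetic Duality Theorems*, I.7.3.
-/

set_option autoImplicit false

open WeierstrassCurve Literature.NumberTheory.EllipticCurves
  Literature.NumberTheory.EllipticCurves.ModularForms
  Literature.NumberTheory.EllipticCurves.Rank1Residual
  Literature.NumberTheory.EllipticCurves.Rank1Residual.Typed
  Summit.BirchSwinnertonDyer.Rank1Residual
  Summit.BirchSwinnertonDyer.BirchSwinnertonDyer.Theses.ByReductionTypeAtTwo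

namespace Summit.BirchSwinnertonDyer.BirchSwinnertonDyer.Theorems

/-- **Glue 19578, PROVED** (statement = the route decl
`Theses.ByReductionTypeAtTwo.GoodOrdinaryRankZeroAtTwoOfChildrenIsoMLB` verbatim): PUB + (Cassels ∧
entire `L`) + Kato half up to isogeny + descent inequality ⇒ `GoodOrdinaryRankZeroAtTwo`.
[cite: GreenbergLNM1716, Thm. 4.1 (p. 102)] [cite: Kato2004Asterisque, Thm. 17.4 (1)(2) (p. 273)]
[cite: MilneADT2006, Thm. I.7.3] -/
theorem goodOrdinaryRankZeroAtTwoOfChildrenIsoMLB_proof : GoodOrdinaryRankZeroAtTwoOfChildrenIsoMLB := by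
  intro hPub hPubI hK hL W _ _ hcm hr hgo
  obtain ⟨hmod, hGZK, h17, hGr⟩ := hPub
  obtain ⟨hCassels, hLfun⟩ := hPubI
  obtain ⟨W', _, _, hiso, hK'⟩ := hK W hcm hr hgo
  have hcm' : ¬ W'.HasCM := fun h => hcm ((X12.hasCM_iff_of_isIsogenous hiso).mpr h)
  have hr' : W'.analyticRank = 0 := by rw [← analyticRank_eq_of_isIsogenous' hiso]; exact hr
  have hgo' : Literature.NumberTheory.EllipticCurves.Rank1Residual.GoodOrd W' 2 :=
    ⟨(hiso.hasGoodReductionAtPrime_iff 2).mp hgo.1,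
      X2.IsogenyLineTypeGoodOrdinary.not_dvd_frobeniusTrace_of_isIsogenous hiso hgo.1 hgo.2⟩
  have hEC : X5.O1.TwoAdicEulerCharRankZero W' 0 :=
    X5.O1.twoAdicEulerCharRankZero_zero_of_greenberg W' hGr
  have hU : MissingUpperBoundAt W' 2 :=
    X5.O1.missingUpperBoundAt_two_of_mainConjectureLowerDivisibilityAtTwoOrd_of_kato W' hEC hmod hGZK
      (fun f => h17 W' f) hr' hgo' hK'
  have hB' : BSDp W' 2 :=
    bsdp_of_missingPPartAt W' 2 hGZK (by omega)
      (missingPPartAt_of_lower_of_upper W' 2 (hL W' hcm' hr' hgo') hU)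
  exact X2.bsdp_of_isIsogenous_of_bsdp hCassels hGZK hLfun W' W hiso.symm_of_charZero 2 (by omega) hB'

end Summit.BirchSwinnertonDyer.BirchSwinnertonDyer.Theorems
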